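import Literature.NumberTheory.Automorphic.UnitaryGroupTruncatedKernelHighCusp
import Literature.NumberTheory.Automorphic.UnitaryGroupKernelOffBorelVanishing
import Literature.NumberTheory.Automorphic.UnitaryGroupRationalLeviDecomposition
import Mathlib.MeasureTheory.Integral.DominatedConvergence
import HarnessLib

/-!
# The Borel kernel of `U(J_N)` fibres over the rational torus: `K_B(x, y) = ν(𝓕)⁻¹ Σ_{t ∈ T(F)} ∫_{N(𝔸_F)} f(x⁻¹ t m y) dν(m)`
(Rogawski, *Automorphic Representations of Unitary Groups in Three Variables* (1990), §2.2, p. 13: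
`K_P(x, y) = Σ_{γ ∈ M_P} ∫_{𝐍_P} f(x⁻¹ γ n y) dn` for `P = B`, `M_P = T`; Arthur, Duke Math. J. 45 (1978), §1)

Topic `NumberTheory/Automorphic`; namespace `Literature.NumberTheory.Automorphic.UnitaryGroup` (§0 in
`Literature.NumberTheory.Automorphic`). THEOREMS ONLY over accepted tree modules: no definition, no named
fact, no `sorry`, no instance, no notation.

The tree's Borel kernel ★ `kernelBorel ν 𝓕 f x y = ν(𝓕)⁻¹ ∫_𝓕 Σ_{β ∈ B(F)} f(x⁻¹ β u y) dν(u)`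
(★ `UnitaryGroupArthurTruncatedKernel`: the `N(F)\N(𝔸_F)`-constant term of the rational Borel sum
★ `borelSum`, for a Haar measure `ν` of `N(𝔸_F)` and a fundamental domain `𝓕` of `N(F)`) is identified
with Rogawski's printed `K_B(x, y) = Σ_{γ ∈ T(F)} ∫_{N(𝔸_F)} f(x⁻¹ γ n y) dn` for `f ∈ C_c(G(𝔸_F))`, using
the rational Levi decomposition `B(F) = T(F) N(F)` of the companion ★ `UnitaryGroupRationalLeviDecomposition`
(`borelSum_eq_tsum_prod`, `finite_setOf_rationalTorus_meets_support`):

* §0 (generic: a countable group `Γ` acting measurably and measure-preservingly on `(α, μ)` with a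
  fundamental domain `s`) `setIntegral_tsum_prod_smul_eq_tsum_integral` — **unfolding a sum of
  translates**: `∫_s Σ_{(i, γ) ∈ ι × Γ} φ_i(γ • a) dμ(a) = Σ_i ∫_α φ_i dμ` for integrable `φ_i` of finite
  total mass (Mathlib `integral_tsum` + `IsFundamentalDomain.integral_eq_tsum''`/`lintegral_eq_tsum''`).
* §1 plumbing: `N(𝔸_F)` is closed in `G(𝔸_F)`, `N(F)` and `T(F)` are countable,
  `hasCompactSupport_comp_mul_adelicUnipotent_mul`: `m ↦ f(a m b)` has compact support on `N(𝔸_F)`; and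
  **`finite_setOf_rationalTorus_meets_support_of_isCompact`** — the finiteness of the torus fibres
  (★ `finite_setOf_rationalTorus_meets_support`) UNIFORMLY for `x ∈ C_x`, `y ∈ C_y` compact: only finitely
  many `t ∈ T(F)` have `f(x⁻¹ t m y) ≠ 0` for some `m ∈ N(𝔸_F)`, `x ∈ C_x`, `y ∈ C_y` (the uniformity over a
  Siegel set used when the fibre terms are estimated in the cusp).
* §2 **`kernelBorel_eq_smul_tsum_integral`** — for `f ∈ C_c(U(J_N)(𝔸_F))`, every Haar measure `ν` of
  `N(𝔸_F)`, every fundamental domain `𝓕` of `N(F)` and all `x, y` (every `N`):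
  `K_B(x, y) = ν(𝓕)⁻¹ · Σ_{t ∈ T(F)} ∫_{N(𝔸_F)} f(x⁻¹ t m y) dν(m)`, i.e. Rogawski's formula for the Haar
  measure `ν(𝓕)⁻¹ ν` giving `N(F)\N(𝔸_F)` volume one; only finitely many `t` contribute
  (`summable_tsum_rationalUnipotent_and_integral`).
* §3 (`N = 3`) **`exists_truncatedKernel_eq_tsum_sub`** — high in the cusp Arthur's truncated kernel is a
  sum over `T(F)` of «sum over the lattice `N(F)` minus normalised integral over `N(𝔸_F)`»: there is
  `c₀ = c₀(f)` with `k^T(g) = Σ_{t ∈ T(F)} (Σ_{n ∈ N(F)} f(g⁻¹ t n g) − ν(𝓕)⁻¹ ∫_{N(𝔸_F)} f(g⁻¹ t m g) dν(m))`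
  whenever `1 ≤ T < H(g)` and `c₀ < H(g)` (★ `truncatedKernel_eq_kernel_sub_kernelBorel`,
  ★ `exists_kernel_eq_borelSum_of_lt_borelHeight`, ★ `borelSum_eq_tsum_tsum`) — the shape to which
  Poisson summation on `N(F)\N(𝔸_F)` is applied, fibre by fibre, in the proof of the integrability of
  `k^T` over the Siegel set (Rogawski (1990), §2.2 p. 13; Arthur (1978), §§6–7).

## References

* J. D. Rogawski, *Automorphic Representations of Unitary Groups in Three Variables*, Annals of
  Mathematics Studies 123 (1990), §2.1 (p. 11), §2.2 (p. 13) [Rogawski1990].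
* P. Garrett, *Modern Analysis of Automorphic Forms by Example* (2018), §2.3, §2.10 [Garrett2018].
-/

noncomputable section

open MeasureTheory NumberField IsDedekindDomain Topology Set
open scoped NNReal ENNReal MatrixGroups

namespace Literature.NumberTheory.Automorphic

/-! ## §0 Unfolding a sum of translates over a fundamental domain -/

section Generic

variable {G α V : Type*} [Group G] [Countable G] [MulAction G α] [MeasurableSpace α]
  [MeasurableConstSMul G α] {μ : Measure α} [SMulInvariantMeasure G α μ]
  [NormedAddCommGroup V] [NormedSpace ℝ V] [CompleteSpace V]

/-- **Unfolding a sum of translates over a fundamental domain.** For a countable group `G` acting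
measurably and measure-preservingly on `(α, μ)` with a fundamental domain `s`, a countable family of
integrable functions `φ_i` of finite total mass `Σ_i ∫ ‖φ_i‖ dμ < ∞`:
`∫_s Σ_{(i, g)} φ_i(g • a) dμ(a) = Σ_i ∫_α φ_i dμ` (the sum over `(i, g) ∈ ι × G` is absolutely convergent
for a.e. `a ∈ s`; Mathlib `integral_tsum` and `IsFundamentalDomain.integral_eq_tsum''`). This is the
unfolding `∫_{N(F)\𝐍} Σ_{γ} φ(γ n) dn = ∫_𝐍 φ dn` of Rogawski (1990), §2.1–§2.2, with an extra finite sum.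
[cite: Rogawski1990, §2.1 (p. 11)] -/
theorem setIntegral_tsum_prod_smul_eq_tsum_integral {s : Set α} (hs : IsFundamentalDomain G s μ)
    {ι : Type*} [Countable ι] {φ : ι → α → V} (hφ : ∀ i, Integrable (φ i) μ)
    (hfin : ∑' i, ∫⁻ a, ‖φ i a‖ₑ ∂μ ≠ ⊤) :
    ∫ a in s, (∑' p : ι × G, φ p.1 (p.2 • a)) ∂μ = ∑' i, ∫ a, φ i a ∂μ := by
  have hmeas : ∀ p : ι × G, AEStronglyMeasurable (fun a => φ p.1 (p.2 • a)) (μ.restrict s) :=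
    fun p => ((hφ p.1).1.comp_quasiMeasurePreserving
      (measurePreserving_smul p.2 μ).quasiMeasurePreserving).restrict
  -- the `L¹` masses unfold: `Σ_{(i, g)} ∫_s ‖φ_i(g • a)‖ = Σ_i ∫ ‖φ_i‖`
  have hlin : ∑' p : ι × G, ∫⁻ a in s, ‖φ p.1 (p.2 • a)‖ₑ ∂μ = ∑' i, ∫⁻ a, ‖φ i a‖ₑ ∂μ := by
    rw [ENNReal.tsum_prod']
    exact tsum_congr fun i => (hs.lintegral_eq_tsum'' (fun a => ‖φ i a‖ₑ)).symm
  have hfin' : ∑' p : ι × G, ∫⁻ a in s, ‖φ p.1 (p.2 • a)‖ₑ ∂μ ≠ ⊤ := by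
    rw [hlin]
    exact hfin
  rw [integral_tsum hmeas hfin']
  -- the integrated family is absolutely summable, so the sum over `ι × G` may be iterated
  have hsum : Summable fun p : ι × G => ∫ a in s, φ p.1 (p.2 • a) ∂μ := by
    refine Summable.of_norm_bounded (ENNReal.summable_toReal hfin') fun p => ?_
    exact (norm_integral_le_lintegral_norm _).trans_eq (by simp only [ofReal_norm])
  rw [hsum.tsum_prod]
  exact tsum_congr fun i => (hs.integral_eq_tsum'' (φ i) (hφ i)).symm

end Generic

namespace UnitaryGroup

variable {F E : Type} [Field F] [NumberField F] [Field E] [NumberField E] [Algebra F E]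
  {c : E ≃ₐ[F] E} {N : ℕ}

/-! ## §1 Plumbing (`N(𝔸_F)` closed, `N(F)`, `T(F)` countable, compact support of the fibre integrands) and the torus fibres meeting a compact set, uniformly -/

omit [NumberField F] [Algebra F E] in
/-- `𝔸_E` is Hausdorff (local copy of the standard three-line argument). [folklore] -/
private theorem t2Space_adeleRing_E₇ : T2Space (AdeleRing (𝓞 E) E) := by
  haveI : T2Space (FiniteAdeleRing (𝓞 E) E) := inferInstanceAs <| T2Space
    (RestrictedProduct (fun w : HeightOneSpectrum (𝓞 E) => w.adicCompletion E)
      (fun w => (w.adicCompletionIntegers E : Set (w.adicCompletion E))) Filter.cofinite)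
  haveI : T2Space (InfiniteAdeleRing E) :=
    inferInstanceAs <| T2Space ((w : InfinitePlace E) → w.Completion)
  exact inferInstanceAs <| T2Space (InfiniteAdeleRing E × FiniteAdeleRing (𝓞 E) E)

/-- `N(𝔸_F)` is closed in `G(𝔸_F)` (private plumbing, as in `UnitaryGroupBorelConstantTermInvariance`).
[folklore] -/
private theorem isClosed_adelicUnipotent₇ :
    IsClosed ((adelicUnipotent F E c N : Set (quasiSplit F E c N).Adelic)) := by
  haveI := t2Space_adeleRing_E₇ (E := E)
  change IsClosed (⇑(adelicVal F E c N ((StdForm.antidiagonal N).over E)) ⁻¹'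
    ((upperUnitriangular (Fin N) (AdeleRing (𝓞 E) E) : Subgroup (GL (Fin N) (AdeleRing (𝓞 E) E))) :
      Set (GL (Fin N) (AdeleRing (𝓞 E) E))))
  exact (isClosed_upperUnitriangular (R := AdeleRing (𝓞 E) E)).preimage continuous_subtype_val

/-- `N(F)` and `T(F)` are countable (they inject into the countable `G(F)`; private plumbing). [folklore] -/
private theorem countable_rationalUnipotent_rationalTorus₇ :
    Countable (rationalUnipotent F E c N) ∧ Countable (rationalTorus F E c N) := by
  haveI : Countable (quasiSplit F E c N).arithmeticSubgroup := by
    haveI : Countable E := NumberField.countable' (K := E)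
    haveI : Countable (Matrix (Fin N) (Fin N) E) := inferInstanceAs (Countable (Fin N → Fin N → E))
    haveI : Countable (GL (Fin N) E) := Units.val_injective.countable
    haveI : Countable (quasiSplit F E c N).Rational :=
      inferInstanceAs (Countable (rational F E c N ((StdForm.antidiagonal N).over E)))
    exact (Set.countable_range _).to_subtype
  have h1 : Function.Injective fun γ : rationalUnipotent F E c N =>
      (⟨((γ : adelicUnipotent F E c N) : (quasiSplit F E c N).Adelic), γ.2⟩ :
        (quasiSplit F E c N).arithmeticSubgroup) := fun a a' h =>
    Subtype.ext (Subtype.ext (congrArg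
      (fun z : (quasiSplit F E c N).arithmeticSubgroup => (z : (quasiSplit F E c N).Adelic)) h))
  have h2 : Function.Injective fun t : rationalTorus F E c N =>
      (⟨((t : torusAdelic F E c N) : (quasiSplit F E c N).Adelic), t.2⟩ :
        (quasiSplit F E c N).arithmeticSubgroup) := fun a a' h =>
    Subtype.ext (Subtype.ext (congrArg
      (fun z : (quasiSplit F E c N).arithmeticSubgroup => (z : (quasiSplit F E c N).Adelic)) h))
  exact ⟨h1.countable, h2.countable⟩

/-- `m ↦ f(a m b)` has compact support on `N(𝔸_F)` when `f` has compact support on `G(𝔸_F)` (`N(𝔸_F)`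
is closed, so `m ↦ a m b` is a closed embedding). [cite: Rogawski1990, §2.2 (p. 13)] -/
theorem hasCompactSupport_comp_mul_adelicUnipotent_mul {f : (quasiSplit F E c N).Adelic → ℂ}
    (hf : HasCompactSupport f) (a b : (quasiSplit F E c N).Adelic) :
    HasCompactSupport fun m : adelicUnipotent F E c N =>
      f (a * ((m : adelicUnipotent F E c N) : (quasiSplit F E c N).Adelic) * b) :=
  hf.comp_isClosedEmbedding
    (((Homeomorph.mulLeft a).trans (Homeomorph.mulRight b)).isClosedEmbedding.comp
      (isClosed_adelicUnipotent₇ (F := F) (E := E) (c := c) (N := N)).isClosedEmbedding_subtypeVal)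

/-- **Only finitely many torus fibres meet the support, uniformly on compacta**: for `f` of compact
support on `U(J_N)(𝔸_F)` and compact `C_x, C_y ⊆ G(𝔸_F)`, the set of `t ∈ T(F)` with `f(x⁻¹ t m y) ≠ 0` for
some `x ∈ C_x`, `y ∈ C_y`, `m ∈ N(𝔸_F)` is finite — such `t` are the torus parts (★ `torusPart`,
continuous) of the compact `B(𝔸_F) ∩ C_x · supp(f) · C_y⁻¹` (`B(𝔸_F)` is closed, ★ `isClosed_borelAdelic`)
and lie in the discrete `G(F)` (★ `finite_setOf_mem_arithmeticSubgroup_of_isCompact`). (Rogawski (1990),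
§2.2: on a Siegel set only finitely many `γ ∈ M_P` contribute to `K_P`.) [cite: Rogawski1990, §2.2 (p. 13)] -/
theorem finite_setOf_rationalTorus_meets_support_of_isCompact {f : (quasiSplit F E c N).Adelic → ℂ}
    (hf : HasCompactSupport f) {Cx Cy : Set (quasiSplit F E c N).Adelic} (hCx : IsCompact Cx)
    (hCy : IsCompact Cy) :
    {t : rationalTorus F E c N | ∃ x ∈ Cx, ∃ y ∈ Cy, ∃ m : adelicUnipotent F E c N,
      f (x⁻¹ * ((t : torusAdelic F E c N) : (quasiSplit F E c N).Adelic) *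
        ((m : adelicUnipotent F E c N) : (quasiSplit F E c N).Adelic) * y) ≠ 0}.Finite := by
  -- the compact set `C_x · supp(f) · C_y⁻¹` and the torus parts of its trace on `B(𝔸_F)`
  set K : Set (quasiSplit F E c N).Adelic :=
    (fun p : ((quasiSplit F E c N).Adelic × (quasiSplit F E c N).Adelic) × (quasiSplit F E c N).Adelic =>
      p.1.1 * p.2 * p.1.2⁻¹) '' ((Cx ×ˢ Cy) ×ˢ tsupport f) with hK
  have hKc : IsCompact K :=
    ((hCx.prod hCy).prod hf).image (by fun_prop)
  have hKB : IsCompact ((Subtype.val : borelAdelic F E c N → (quasiSplit F E c N).Adelic) ⁻¹' K) :=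
    isClosed_borelAdelic.isClosedEmbedding_subtypeVal.isCompact_preimage hKc
  have hC : IsCompact ((Subtype.val : borelAdelic F E c N → (quasiSplit F E c N).Adelic) ''
      (torusPart '' ((Subtype.val : borelAdelic F E c N → (quasiSplit F E c N).Adelic) ⁻¹' K))) :=
    (hKB.image continuous_torusPart).image continuous_subtype_val
  have hfin := finite_setOf_mem_arithmeticSubgroup_of_isCompact hC 1 1
  -- `T(F) ↪ G(F)`
  have hι : Function.Injective fun t : rationalTorus F E c N =>
      (⟨((t : torusAdelic F E c N) : (quasiSplit F E c N).Adelic), t.2⟩ :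
        (quasiSplit F E c N).arithmeticSubgroup) := fun a a' h =>
    Subtype.ext (Subtype.ext (congrArg
      (fun z : (quasiSplit F E c N).arithmeticSubgroup => (z : (quasiSplit F E c N).Adelic)) h))
  refine (hfin.preimage hι.injOn).subset ?_
  rintro t ⟨x, hx, y, hy, m, hm⟩
  change (1 : (quasiSplit F E c N).Adelic)⁻¹ * ((t : torusAdelic F E c N) : (quasiSplit F E c N).Adelic) * 1 ∈
    (Subtype.val : borelAdelic F E c N → (quasiSplit F E c N).Adelic) ''
      (torusPart '' ((Subtype.val : borelAdelic F E c N → (quasiSplit F E c N).Adelic) ⁻¹' K))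
  rw [inv_one, one_mul, mul_one]
  have htB := torusAdelic_le_borelAdelic t.1.2
  have hbB : ((t : torusAdelic F E c N) : (quasiSplit F E c N).Adelic) *
      ((m : adelicUnipotent F E c N) : (quasiSplit F E c N).Adelic) ∈ borelAdelic F E c N :=
    Subgroup.mul_mem _ htB (adelicUnipotent_le_borelAdelic m.2)
  refine ⟨torusPart ⟨_, hbB⟩, ⟨⟨_, hbB⟩, ?_, rfl⟩, ?_⟩
  · -- `t m = x · (x⁻¹ (t m) y) · y⁻¹ ∈ K`
    refine ⟨((x, y), x⁻¹ * (((t : torusAdelic F E c N) : (quasiSplit F E c N).Adelic) *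
      ((m : adelicUnipotent F E c N) : (quasiSplit F E c N).Adelic)) * y),
      ⟨⟨hx, hy⟩, ?_⟩, ?_⟩
    · rw [← mul_assoc]
      exact subset_tsupport _ hm
    · change x * (x⁻¹ * (((t : torusAdelic F E c N) : (quasiSplit F E c N).Adelic) *
          ((m : adelicUnipotent F E c N) : (quasiSplit F E c N).Adelic)) * y) * y⁻¹ = _
      rw [mul_assoc x, mul_inv_cancel_right, mul_inv_cancel_left]
  · rw [torusPart_mul_of_mem_torusAdelic_of_mem_adelicUnipotent t.1.2 m.2]

/-! ## §2 `K_B(x, y) = ν(𝓕)⁻¹ Σ_{t ∈ T(F)} ∫_{N(𝔸_F)} f(x⁻¹ t m y) dν(m)` -/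

section KernelBorel

variable [MeasurableSpace (adelicUnipotent F E c N)] [BorelSpace (adelicUnipotent F E c N)]

/-- **Rogawski's formula for the Borel kernel** (`U(J_N)`, every `N`): for `f ∈ C_c(G(𝔸_F))`, a Haar
measure `ν` of `N(𝔸_F)`, a fundamental domain `𝓕` of `N(F)` in `N(𝔸_F)` and all `x, y ∈ G(𝔸_F)`,
`K_B(x, y) = ν(𝓕)⁻¹ · Σ_{t ∈ T(F)} ∫_{N(𝔸_F)} f(x⁻¹ t m y) dν(m)`
— the tree's ★ `kernelBorel ν 𝓕 f x y = ν(𝓕)⁻¹ ∫_𝓕 Σ_{β ∈ B(F)} f(x⁻¹ β u y) dν(u)` IS the printed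
`K_P(x, y) = Σ_{γ ∈ M_P} ∫_{𝐍_P} f(x⁻¹ γ n y) dn` (`P = B`, Tamagawa `dn`: `N(F)\𝐍` of volume one).
Proof: `B(F) = T(F) N(F)` (★ `borelSum_eq_tsum_prod`), then unfold `∫_𝓕 Σ_{n ∈ N(F)} = ∫_{N(𝔸_F)}` fibre
by fibre (§0); only finitely many fibres are non-zero (★ `finite_setOf_rationalTorus_meets_support`). [cite: Rogawski1990, §2.2 (p. 13)] -/
theorem kernelBorel_eq_smul_tsum_integral (ν : Measure (adelicUnipotent F E c N)) [ν.IsHaarMeasure]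
    {𝓕 : Set (adelicUnipotent F E c N)} (h𝓕 : IsFundamentalDomain (rationalUnipotent F E c N) 𝓕 ν)
    {f : (quasiSplit F E c N).Adelic → ℂ} (hfc : Continuous f) (hf : HasCompactSupport f)
    (x y : (quasiSplit F E c N).Adelic) :
    kernelBorel ν 𝓕 f x y = ((ν 𝓕).toReal⁻¹ : ℝ) •
      ∑' t : rationalTorus F E c N, ∫ m : adelicUnipotent F E c N,
        f (x⁻¹ * ((t : torusAdelic F E c N) : (quasiSplit F E c N).Adelic) *
          ((m : adelicUnipotent F E c N) : (quasiSplit F E c N).Adelic) * y) ∂ν := by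
  obtain ⟨hcN, hcT⟩ := countable_rationalUnipotent_rationalTorus₇ (F := F) (E := E) (c := c) (N := N)
  haveI := hcN
  haveI := hcT
  haveI : MeasurableConstSMul (rationalUnipotent F E c N) (adelicUnipotent F E c N) :=
    ⟨fun γ => (continuous_const.mul continuous_id).measurable⟩
  haveI : SMulInvariantMeasure (rationalUnipotent F E c N) (adelicUnipotent F E c N) ν :=
    ⟨fun γ s _hs => by
      rw [show (fun u : adelicUnipotent F E c N => γ • u) ⁻¹' s =
          (fun u : adelicUnipotent F E c N => ((γ : adelicUnipotent F E c N)) * u) ⁻¹' s from rfl,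
        measure_preimage_mul]⟩
  -- the fibre integrands `φ_t(m) = f(x⁻¹ t m y)`
  set φ : rationalTorus F E c N → adelicUnipotent F E c N → ℂ := fun t m =>
    f (x⁻¹ * ((t : torusAdelic F E c N) : (quasiSplit F E c N).Adelic) *
      ((m : adelicUnipotent F E c N) : (quasiSplit F E c N).Adelic) * y) with hφ
  have hφc : ∀ t, Continuous (φ t) := fun t =>
    hfc.comp ((continuous_const.mul continuous_subtype_val).mul continuous_const)
  have hφi : ∀ t, Integrable (φ t) ν := fun t =>
    (hφc t).integrable_of_hasCompactSupport (hasCompactSupport_comp_mul_adelicUnipotent_mul hf _ _)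
  -- pointwise fibration of the Borel sum over `T(F) × N(F)`
  have hpt : ∀ u : adelicUnipotent F E c N,
      borelSum f x (((u : adelicUnipotent F E c N) : (quasiSplit F E c N).Adelic) * y) =
        ∑' p : rationalTorus F E c N × rationalUnipotent F E c N, φ p.1 (p.2 • u) := by
    intro u
    rw [borelSum_eq_tsum_prod]
    refine tsum_congr fun p => ?_
    simp only [hφ, Subgroup.smul_def, smul_eq_mul, Subgroup.coe_mul, mul_assoc]
  -- only finitely many fibres are non-zero, so the total `L¹` mass is finite
  have hS := finite_setOf_rationalTorus_meets_support hf x y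
  have hzero : ∀ t ∉ hS.toFinset, φ t = 0 := by
    intro t ht
    funext m
    by_contra h
    exact ht (hS.mem_toFinset.2 ⟨m, h⟩)
  have hfin : ∑' t, ∫⁻ m, ‖φ t m‖ₑ ∂ν ≠ ⊤ := by
    rw [tsum_eq_sum (s := hS.toFinset) (fun t ht => by rw [hzero t ht]; simp)]
    exact ENNReal.sum_ne_top.2 fun t _ => (hφi t).2.ne
  rw [kernelBorel_eq_smul_integral]
  congr 1
  simp_rw [hpt]
  exact setIntegral_tsum_prod_smul_eq_tsum_integral h𝓕 hφi hfin

/-- The diagonal case: **`K_B(g, g) = ν(𝓕)⁻¹ Σ_{t ∈ T(F)} ∫_{N(𝔸_F)} f(g⁻¹ t m g) dν(m)`**.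
[cite: Rogawski1990, §2.2 (p. 13)] -/
theorem kernelBorel_diag_eq_smul_tsum_integral (ν : Measure (adelicUnipotent F E c N)) [ν.IsHaarMeasure]
    {𝓕 : Set (adelicUnipotent F E c N)} (h𝓕 : IsFundamentalDomain (rationalUnipotent F E c N) 𝓕 ν)
    {f : (quasiSplit F E c N).Adelic → ℂ} (hfc : Continuous f) (hf : HasCompactSupport f)
    (g : (quasiSplit F E c N).Adelic) :
    kernelBorel ν 𝓕 f g g = ((ν 𝓕).toReal⁻¹ : ℝ) •
      ∑' t : rationalTorus F E c N, ∫ m : adelicUnipotent F E c N,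
        f (g⁻¹ * ((t : torusAdelic F E c N) : (quasiSplit F E c N).Adelic) *
          ((m : adelicUnipotent F E c N) : (quasiSplit F E c N).Adelic) * g) ∂ν :=
  kernelBorel_eq_smul_tsum_integral ν h𝓕 hfc hf g g

omit [BorelSpace (adelicUnipotent F E c N)] in
/-- The two `T(F)`-families of §3 have finite support: `t ↦ Σ_{n ∈ N(F)} f(g⁻¹ t n g)` and
`t ↦ ∫_{N(𝔸_F)} f(g⁻¹ t m g) dν(m)` vanish off the finite set ★ `finite_setOf_rationalTorus_meets_support`. [cite: Rogawski1990, §2.2 (p. 13)] -/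
theorem summable_tsum_rationalUnipotent_and_integral (ν : Measure (adelicUnipotent F E c N))
    {f : (quasiSplit F E c N).Adelic → ℂ} (hf : HasCompactSupport f) (g : (quasiSplit F E c N).Adelic) :
    (Summable fun t : rationalTorus F E c N => ∑' n : rationalUnipotent F E c N,
      f (g⁻¹ * ((t : torusAdelic F E c N) : (quasiSplit F E c N).Adelic) *
        ((n : adelicUnipotent F E c N) : (quasiSplit F E c N).Adelic) * g)) ∧
    Summable fun t : rationalTorus F E c N => ∫ m : adelicUnipotent F E c N,
      f (g⁻¹ * ((t : torusAdelic F E c N) : (quasiSplit F E c N).Adelic) *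
        ((m : adelicUnipotent F E c N) : (quasiSplit F E c N).Adelic) * g) ∂ν := by
  have hS := finite_setOf_rationalTorus_meets_support hf g g
  refine ⟨summable_of_hasFiniteSupport (hS.subset fun t ht => ?_),
    summable_of_hasFiniteSupport (hS.subset fun t ht => ?_)⟩
  · by_contra hS'
    apply ht
    have h0 : (fun n : rationalUnipotent F E c N =>
        f (g⁻¹ * ((t : torusAdelic F E c N) : (quasiSplit F E c N).Adelic) *
          ((n : adelicUnipotent F E c N) : (quasiSplit F E c N).Adelic) * g)) = fun _ => 0 := by
      funext n
      by_contra h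
      exact hS' ⟨(n : adelicUnipotent F E c N), h⟩
    change (∑' n : rationalUnipotent F E c N,
      f (g⁻¹ * ((t : torusAdelic F E c N) : (quasiSplit F E c N).Adelic) *
        ((n : adelicUnipotent F E c N) : (quasiSplit F E c N).Adelic) * g)) = 0
    rw [h0, tsum_zero]
  · by_contra hS'
    apply ht
    have h0 : (fun m : adelicUnipotent F E c N =>
        f (g⁻¹ * ((t : torusAdelic F E c N) : (quasiSplit F E c N).Adelic) *
          ((m : adelicUnipotent F E c N) : (quasiSplit F E c N).Adelic) * g)) = fun _ => 0 := by
      funext m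
      by_contra h
      exact hS' ⟨m, h⟩
    change (∫ m : adelicUnipotent F E c N,
      f (g⁻¹ * ((t : torusAdelic F E c N) : (quasiSplit F E c N).Adelic) *
        ((m : adelicUnipotent F E c N) : (quasiSplit F E c N).Adelic) * g) ∂ν) = 0
    rw [h0, integral_zero]

end KernelBorel

/-! ## §3 `N = 3`: high in the cusp `k^T(g) = Σ_{t ∈ T(F)} (Σ_{N(F)} − ν(𝓕)⁻¹ ∫_{N(𝔸_F)})` -/

section HighCusp

variable [MeasurableSpace (adelicUnipotent F E c 3)] [BorelSpace (adelicUnipotent F E c 3)]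

/-- **High in the cusp the truncated kernel of `U(3)` is a sum over `T(F)` of «lattice sum minus
integral» over `N`**: for `f ∈ C_c(U(J₃)(𝔸_F))`, a Haar measure `ν` of `N(𝔸_F)` and a fundamental domain
`𝓕` of `N(F)` there is `c₀ = c₀(f)` such that for all `g` and `T` with `1 ≤ T < H(g)` and `c₀ < H(g)`:
`k^T(g) = Σ_{t ∈ T(F)} ( Σ_{n ∈ N(F)} f(g⁻¹ t n g) − ν(𝓕)⁻¹ ∫_{N(𝔸_F)} f(g⁻¹ t m g) dν(m) )`
(★ `truncatedKernel_eq_kernel_sub_kernelBorel`: `k^T = K − K_B` there; ★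
`exists_kernel_eq_borelSum_of_lt_borelHeight`: `K(g, g) = Σ_{B(F)}` there; ★ `borelSum_eq_tsum_tsum` and §2). This is the
expression to which Poisson summation on `N(F)\N(𝔸_F)` is applied, fibre by fibre, in the proof that
`k^T` is integrable (Rogawski (1990), §2.2, p. 13; Arthur (1978), §7). [cite: Rogawski1990, §2.2 (p. 13)] -/
theorem exists_truncatedKernel_eq_tsum_sub (ν : Measure (adelicUnipotent F E c 3)) [ν.IsHaarMeasure]
    {𝓕 : Set (adelicUnipotent F E c 3)} (h𝓕 : IsFundamentalDomain (rationalUnipotent F E c 3) 𝓕 ν)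
    {f : (quasiSplit F E c 3).Adelic → ℂ} (hfc : Continuous f) (hf : HasCompactSupport f) :
    ∃ c₀ : ℝ≥0, ∀ (g : (quasiSplit F E c 3).Adelic) (T : ℝ≥0), 1 ≤ T → T < borelHeight g →
      c₀ < borelHeight g →
        truncatedKernel ν 𝓕 T f g = ∑' t : rationalTorus F E c 3,
          (∑' n : rationalUnipotent F E c 3,
              f (g⁻¹ * ((t : torusAdelic F E c 3) : (quasiSplit F E c 3).Adelic) *
                ((n : adelicUnipotent F E c 3) : (quasiSplit F E c 3).Adelic) * g) -
            ((ν 𝓕).toReal⁻¹ : ℝ) • ∫ m : adelicUnipotent F E c 3,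
              f (g⁻¹ * ((t : torusAdelic F E c 3) : (quasiSplit F E c 3).Adelic) *
                ((m : adelicUnipotent F E c 3) : (quasiSplit F E c 3).Adelic) * g) ∂ν) := by
  obtain ⟨c₀, hc₀⟩ := exists_kernel_eq_borelSum_of_lt_borelHeight hf
  refine ⟨c₀, fun g T hT hTg hcg => ?_⟩
  obtain ⟨ha, hb⟩ := summable_tsum_rationalUnipotent_and_integral ν hf g
  rw [truncatedKernel_eq_kernel_sub_kernelBorel ν h𝓕 f hT hTg, hc₀ g hcg, borelSum_eq_tsum_tsum hf,
    kernelBorel_eq_smul_tsum_integral ν h𝓕 hfc hf, ← hb.tsum_const_smul _,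
    ← ha.tsum_sub (hb.const_smul _)]

end HighCusp

end UnitaryGroup

end Literature.NumberTheory.Automorphic
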